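import Mathlib.Analysis.InnerProductSpace.PiL2
import Mathlib.Analysis.SpecialFunctions.Complex.Arg
import Mathlib.Analysis.SpecialFunctions.Trigonometric.Inverse
import Mathlib.Data.Set.Card
import Literature.Geometry.DiscreteGeometry.Fan
import HarnessLib

/-!
# Contact graphs of spherical codes: planarity (the contact fan), the angle bound `α(ψ)`,
# and degree `≤ 5` (Musin–Tarasov 2012, Propositions 3.1, 3.3, 3.6 (ii), 3.7) — proved

Topic `Literature/Geometry/DiscreteGeometry`; first bricks, in printed order, of the proof of
Theorem 1 of O. R. Musin, A. S. Tarasov, *The strong thirteen spheres problem*, Discrete Comput.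
Geom. 48 (2012) 128–141 [`MusinTarasov2012`] (the tree's named fact
`musinTarasov2012_tammes_thirteen`, file `TammesThirteen.lean`; its lower-bound half is PROVED in
`TammesThirteenLowerBound.lean`).  Everything here is a definition or PROVED; no named facts.
Sibling of `Fan.lean` (Hales's fans, which give the tree's notion of a planar geodesic graph on
the sphere) and `KissingNodeDegree.lean` (the same tangent-coordinate method at `60°`), whose
kissing-case statements (`isFan_contactGraph`, degree `≤ 4` under Hales's separation) are the
special case `κ = 1/2` on `S²(2)`.

## Source (verbatim)

* §2.1 (p. 4 of arXiv:1002.1439v3): "**Contact graphs.** Let `X` be a finite set in `S²`. The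
  contact graph `CG(X)` is the graph with vertices in `X` and edges `(x, y)`, `x, y ∈ X` such that
  `dist(x, y) = ψ(X)`", where (§1.2) `ψ(X) := min_{x ≠ y ∈ X} dist(x, y)` is the minimal angular
  distance.
* "**Proposition 3.1.** Let `X` be a finite set in `S²`. Then `CG(X)` is a planar graph.
  *Proof.* Let `a, b, x, y ∈ X` with `dist(a, b) = dist(x, y) = ψ(X)`. Then the shortest arcs `ab`
  and `xy` don't intersect. Otherwise, the length of at least one of the arcs `ax, ay, bx, by` has
  to be less than `ψ(X)`. This yields the planarity of `CG(X)`."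
* "**Proposition 3.3.** Let `X ⊂ S²`. If the graph `CG(X)` is irreducible, then degrees of its
  vertices can take only the values `0` (isolated vertices), `3`, `4`, or `5`."
* "**Proposition 3.6.** […] `uᵢ ≥ α(ψ(X))` for all `uᵢ`, where `α(d) := cos⁻¹(cos d/(1 + cos d))`
  is the angle of a regular triangle in `S²` with sides of length `d`"; "**Proposition 3.7.** Let
  `F` be a triangular face of `G₁₃` with angles `u₁, u₂, u₃`. Then `u₁ = u₂ = u₃ = α₁₃ := α(d₁₃)`."

## What is proved, and in which form

Throughout, points of the sphere are unit vectors of a real inner product space `F` and angular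
distances are encoded by inner products: `dist_{S}(x, y) = ψ ↔ ⟪x, y⟫ = cos ψ =: κ`, and
`dist_{S}(x, y) ≥ ψ ↔ ⟪x, y⟫ ≤ κ` (chordal: `‖x − y‖ = m ↔ ⟪x, y⟫ = 1 − m²/2`,
`dist_eq_iff_inner_eq_of_unit`, `le_dist_iff_inner_le_of_unit`).

* Part A (any `F`): the cone lemmas for unit vectors at a common contact level `κ ∈ (−1, 1)` —
  `unit_eq_zero_of_edge_pair_pair` (two disjoint contact edges: `C{a,b} ∩ C{c,d} = {0}`, i.e. the
  two shortest arcs do not meet — the printed proof of Proposition 3.1, done by the identity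
  `‖s a + t b‖² = (1+κ)/2 (s+t)² + (1−κ)/2 (s−t)²` instead of the triangle inequality on `S²`),
  `unit_eq_zero_of_edge_pair_shared` (two edges at a vertex overlap only in the vertex),
  `unit_eq_zero_of_edge_pair_ray` (no third vertex on an edge), `not_collinear_of_sq_inner_lt_one`.
* Part B (any `F`): `codeContactGraph S κ` — the graph of pairs at inner product exactly `κ`
  (`= CG(S)` for `κ = cos ψ(S)`; `codeContactGraph_adj_iff_dist` is the chordal reading); and
  **Proposition 3.1 as a fan**: `isFan_codeContactGraph` — for `S` finite, nonempty, unit, `κ > −1`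
  and all distinct pairs at inner product `≤ κ`, `(S, codeContactGraph S κ)` is a fan in the sense
  of Hales (`IsFan`, `Fan.lean`: `0 ∉ S`, edges not collinear with `0`, and
  `C(ε) ∩ C(ε′) = C(ε ∩ ε′)` for all cells), which is the precise content of "the geodesic drawing
  of `CG(X)` is planar" used later for faces; `isFan_codeContactGraph_of_le_dist` (distance
  form), `cone_pair_inter_cone_pair_of_codeContactGraph` (the printed non-crossing statement).
  The proof is dimension-free; the paper states it on `S²`.
* Part C: `tangentProj v u = u − ⟪v, u⟫ v` and **Proposition 3.6 (ii) / 3.7**: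
  `inner_tangentProj_le` / `inner_tangentProj_le'` — two contact neighbours `u, u'` of `v`
  (`⟪v, u⟫ = ⟪v, u'⟫ = κ`) at mutual distance `≥ ψ` (`⟪u, u'⟫ ≤ κ`) subtend at `v` an angle of
  cosine `≤ κ/(1 + κ)`, i.e. `≥ α(ψ)`, with equality `inner_tangentProj_eq` for a contact triangle
  (regular, all angles `α(ψ)`); and **Proposition 3.3, the bound `≤ 5`** (the part that holds for
  every contact graph; the exclusion of degrees `1, 2` needs irreducibility = Danzer's shifts and is
  NOT formalised here): `no_six_neighbours`, `card_le_five_of_neighbours`,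
  `finite_and_ncard_le_five_of_neighbours` on `S² ⊂ ℝ³`, and for the graph
  `ncard_neighborSet_codeContactGraph_le_five`, `degree_codeContactGraph_le_five`,
  `card_edgeFinset_codeContactGraph_le` (`2|E| ≤ 5|S|`).  Method: orthonormal frame with third
  vector `v`; a neighbour is `(X, Y, κ)` with `X² + Y² = 1 − κ²`; `⟪uᵢ, uⱼ⟫ =
  (1 − κ²) cos(θᵢ − θⱼ) + κ² ≤ κ` forces `cos(θᵢ − θⱼ) ≤ κ/(1+κ) < 1/2`; six sorted directions
  with all gaps `> π/3` do not fit (`six_gaps_false`, `six_sorted_angles_false`).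

Not here (later bricks of the printed proof): `ψ`, `d_N` and maximal arrangements (§1.2),
shifts / Danzer flips / irreducibility and Proposition 3.2 (Danzer 1986), faces of the fan and
Propositions 3.4–3.5, 3.8–3.11, the enumeration of §4 and the endgame of §5.

## References

* O. R. Musin, A. S. Tarasov, *The strong thirteen spheres problem*, Discrete Comput. Geom. 48
  (2012) 128–141, doi:10.1007/s00454-011-9392-2 = arXiv:1002.1439: §2.1, Propositions 3.1, 3.3,
  3.6, 3.7. [`MusinTarasov2012`]
* L. Danzer, *Finite point-sets on `S²` with minimum distance as large as possible*, Discrete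
  Math. 60 (1986) 3–66 (source of Propositions 3.2–3.4, cited there as [Dan]).
* T. C. Hales, arXiv:1209.6043 (2012), Definition 3 (fans) — `Fan.lean`. [`Hales2012`]
-/

noncomputable section

namespace Literature.Geometry.DiscreteGeometry

open Real RealInnerProductSpace

/-! ### Part A. Blades and node rays of unit vectors at a common contact level `κ` -/

section UnitCone

variable {F : Type*} [NormedAddCommGroup F] [InnerProductSpace ℝ F]

/-- `‖s a + t b‖² = s² + t² + 2st⟪a, b⟫` for unit vectors `a, b`. [folklore] -/
theorem inner_self_comb_unit {a b : F} (ha : ‖a‖ = 1) (hb : ‖b‖ = 1) (s t : ℝ) :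
    ⟪s • a + t • b, s • a + t • b⟫ = s ^ 2 + t ^ 2 + 2 * s * t * ⟪a, b⟫ := by
  have haa : ⟪a, a⟫ = 1 := by rw [real_inner_self_eq_norm_sq, ha]; norm_num
  have hbb : ⟪b, b⟫ = 1 := by rw [real_inner_self_eq_norm_sq, hb]; norm_num
  have hba : ⟪b, a⟫ = ⟪a, b⟫ := real_inner_comm _ _
  simp only [inner_add_left, inner_add_right, real_inner_smul_left, real_inner_smul_right, haa, hbb,
    hba]
  ring

/-- Two distinct unit vectors have inner product `< 1`. [folklore] -/
theorem inner_lt_one_of_ne_unit {a b : F} (ha : ‖a‖ = 1) (hb : ‖b‖ = 1) (hab : a ≠ b) :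
    ⟪a, b⟫ < 1 :=
  (inner_lt_one_iff_real_of_norm_eq_one ha hb).2 hab

/-- **Two disjoint contact edges do not cross.**  Let `a, b, c, d` be unit vectors with
`⟪a, b⟫ = ⟪c, d⟫ = κ` (two edges of a contact graph at level `κ ∈ (-1, 1)`) whose four cross
inner products are `≤ κ` (the cross pairs are at angular distance `≥ arccos κ`).  If
`s a + t b = s′ c + t′ d` with `s, t, s′, t′ ≥ 0` then `s = t = 0`, i.e. the blades `C{a, b}` and
`C{c, d}` meet only at `0`: with `N` the squared norm of the common point,
`2N = (s² + t² + 2stκ) + (s′² + t′² + 2s′t′κ)` while `N ≤ κ(s + t)(s′ + t′)`; for `κ ≥ 0` this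
gives `(1 − κ)(s² + t² + s′² + t′²) ≤ −κ(s + t − s′ − t′)² ≤ 0`, and for `κ < 0` it gives `N ≤ 0`
where `N = (1+κ)/2 · (s + t)² + (1−κ)/2 · (s − t)²`.  (Musin–Tarasov: "the shortest arcs `ab` and
`xy` don't intersect. Otherwise, the length of at least one of the arcs `ax, ay, bx, by` has to
be less than `ψ(X)`.")
[cite: MusinTarasov2012, Proposition 3.1 (proof)] -/
theorem unit_eq_zero_of_edge_pair_pair {a b c d : F} (ha : ‖a‖ = 1) (hb : ‖b‖ = 1) (hc : ‖c‖ = 1)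
    (hd : ‖d‖ = 1) {κ : ℝ} (hκ₁ : κ < 1) (hκ₂ : -1 < κ) (hab : ⟪a, b⟫ = κ) (hcd : ⟪c, d⟫ = κ)
    (hac : ⟪a, c⟫ ≤ κ) (had : ⟪a, d⟫ ≤ κ) (hbc : ⟪b, c⟫ ≤ κ) (hbd : ⟪b, d⟫ ≤ κ)
    {s t s' t' : ℝ} (hs : 0 ≤ s) (ht : 0 ≤ t) (hs' : 0 ≤ s') (ht' : 0 ≤ t')
    (h : s • a + t • b = s' • c + t' • d) : s = 0 ∧ t = 0 := by
  set N := ⟪s • a + t • b, s • a + t • b⟫ with hN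
  have hN1 : N = s ^ 2 + t ^ 2 + 2 * s * t * κ := by rw [hN, inner_self_comb_unit ha hb, hab]
  have hN2 : N = s' ^ 2 + t' ^ 2 + 2 * s' * t' * κ := by
    rw [hN, h, inner_self_comb_unit hc hd, hcd]
  have hN3 : N = ⟪s • a + t • b, s' • c + t' • d⟫ := by
    rw [hN]; exact congrArg (fun y => ⟪s • a + t • b, y⟫) h
  have hN4 : N ≤ κ * ((s + t) * (s' + t')) := by
    rw [hN3]
    simp only [inner_add_left, inner_add_right, real_inner_smul_left, real_inner_smul_right]
    nlinarith [mul_le_mul_of_nonneg_left hac (mul_nonneg hs hs'),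
      mul_le_mul_of_nonneg_left had (mul_nonneg hs ht'),
      mul_le_mul_of_nonneg_left hbc (mul_nonneg ht hs'),
      mul_le_mul_of_nonneg_left hbd (mul_nonneg ht ht')]
  have hN0 : 0 ≤ N := real_inner_self_nonneg
  rcases le_or_gt 0 κ with hκ0 | hκ0
  · -- `κ ≥ 0`: `(1 - κ) Σ squares ≤ 0`
    have key : (1 - κ) * (s ^ 2 + t ^ 2 + s' ^ 2 + t' ^ 2) ≤ 0 := by
      nlinarith [mul_nonneg hκ0 (sq_nonneg (s + t - (s' + t')))]
    have hsum : s ^ 2 + t ^ 2 + s' ^ 2 + t' ^ 2 ≤ 0 := by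
      by_contra hlt
      have : 0 < (1 - κ) * (s ^ 2 + t ^ 2 + s' ^ 2 + t' ^ 2) :=
        mul_pos (by linarith) (not_le.1 hlt)
      linarith
    constructor <;> nlinarith [sq_nonneg s, sq_nonneg t, sq_nonneg s', sq_nonneg t']
  · -- `κ < 0`: `N ≤ 0`
    have hNle : N ≤ 0 := by
      have : κ * ((s + t) * (s' + t')) ≤ 0 :=
        mul_nonpos_of_nonpos_of_nonneg hκ0.le (mul_nonneg (by linarith) (by linarith))
      linarith
    have hsos : N = (1 + κ) / 2 * (s + t) ^ 2 + (1 - κ) / 2 * (s - t) ^ 2 := by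
      rw [hN1]; ring
    have h1 : 0 ≤ (1 + κ) / 2 * (s + t) ^ 2 := mul_nonneg (by linarith) (sq_nonneg _)
    have h2 : 0 ≤ (1 - κ) / 2 * (s - t) ^ 2 := mul_nonneg (by linarith) (sq_nonneg _)
    have hst : (s + t) ^ 2 = 0 := by
      have : (1 + κ) / 2 * (s + t) ^ 2 = 0 := by linarith
      rcases mul_eq_zero.1 this with h | h
      · exact absurd h (by linarith)
      · exact h
    have hst' : s + t = 0 := pow_eq_zero_iff two_ne_zero |>.1 hst
    constructor <;> linarith

/-- **Two contact edges with a common node meet along the node ray.**  Let `a, b, c` be unit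
vectors with `⟪a, b⟫ = ⟪a, c⟫` (two edges of equal length at `a`) and `b ≠ c`.  If
`s a + t b = s′ a + t′ c` with `t, t′ ≥ 0` then `t = t′ = 0`: pairing with `b` and with `c` and
subtracting gives `(t + t′)(1 − ⟪b, c⟫) = 0` with `⟪b, c⟫ < 1`.
[cite: MusinTarasov2012, Proposition 3.1 (proof)] -/
theorem unit_eq_zero_of_edge_pair_shared {a b c : F} (hb : ‖b‖ = 1) (hc : ‖c‖ = 1)
    (hbc : b ≠ c) (habc : ⟪a, b⟫ = ⟪a, c⟫) {s t s' t' : ℝ} (ht : 0 ≤ t) (ht' : 0 ≤ t')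
    (h : s • a + t • b = s' • a + t' • c) : t = 0 ∧ t' = 0 := by
  have hbb : ⟪b, b⟫ = 1 := by rw [real_inner_self_eq_norm_sq, hb]; norm_num
  have hcc : ⟪c, c⟫ = 1 := by rw [real_inner_self_eq_norm_sq, hc]; norm_num
  have hcb : ⟪c, b⟫ = ⟪b, c⟫ := real_inner_comm _ _
  have hlt : ⟪b, c⟫ < 1 := inner_lt_one_of_ne_unit hb hc hbc
  have e1 : ⟪s • a + t • b, b⟫ = ⟪s' • a + t' • c, b⟫ := by rw [h]
  have e2 : ⟪s • a + t • b, c⟫ = ⟪s' • a + t' • c, c⟫ := by rw [h]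
  simp only [inner_add_left, real_inner_smul_left, hbb, hcc, hcb] at e1 e2
  rw [← habc] at e2
  have key : (t + t') * (1 - ⟪b, c⟫) = 0 := by linear_combination e1 - e2
  have htt : t + t' = 0 := by
    rcases mul_eq_zero.1 key with h | h
    · exact h
    · exact absurd h (by linarith)
  constructor <;> linarith

/-- **A contact edge and the ray of a third node meet only at `0`.**  Let `a, b, c` be unit vectors
with `⟪a, b⟫ = κ ∈ (-1, 1)` and `⟪a, c⟫, ⟪b, c⟫ ≤ κ`.  If `s a + t b = r c` with `s, t, r ≥ 0` then
`r = s = t = 0`: `r = ⟪s a + t b, c⟫ ≤ κ(s + t)` and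
`r² = ‖s a + t b‖² = (1+κ)/2 · (s+t)² + (1−κ)/2 · (s−t)²`, so for `κ ≥ 0`
`(1 + κ)(s + t)² ≤ 2κ²(s + t)²` with `1 + κ − 2κ² = (1 − κ)(1 + 2κ) > 0`, and for `κ < 0`
directly `r ≤ 0`.
[cite: MusinTarasov2012, Proposition 3.1 (proof)] -/
theorem unit_eq_zero_of_edge_pair_ray {a b c : F} (ha : ‖a‖ = 1) (hb : ‖b‖ = 1) (hc : ‖c‖ = 1)
    {κ : ℝ} (hκ₁ : κ < 1) (hκ₂ : -1 < κ) (hab : ⟪a, b⟫ = κ) (hac : ⟪a, c⟫ ≤ κ) (hbc : ⟪b, c⟫ ≤ κ)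
    {s t r : ℝ} (hs : 0 ≤ s) (ht : 0 ≤ t) (hr : 0 ≤ r) (h : s • a + t • b = r • c) :
    r = 0 ∧ s = 0 ∧ t = 0 := by
  set N := ⟪s • a + t • b, s • a + t • b⟫ with hN
  have hN1 : N = s ^ 2 + t ^ 2 + 2 * s * t * κ := by rw [hN, inner_self_comb_unit ha hb, hab]
  have hcc : ⟪c, c⟫ = 1 := by rw [real_inner_self_eq_norm_sq, hc]; norm_num
  have hN2 : N = r ^ 2 := by
    rw [hN, h, real_inner_smul_left, real_inner_smul_right, hcc]; ring
  have hr1 : r = ⟪s • a + t • b, c⟫ := by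
    rw [h, real_inner_smul_left, hcc, mul_one]
  have hr2 : r ≤ κ * (s + t) := by
    rw [hr1]
    simp only [inner_add_left, real_inner_smul_left]
    nlinarith [mul_le_mul_of_nonneg_left hac hs, mul_le_mul_of_nonneg_left hbc ht]
  have hsos : N = (1 + κ) / 2 * (s + t) ^ 2 + (1 - κ) / 2 * (s - t) ^ 2 := by rw [hN1]; ring
  -- it suffices to show `s + t = 0`
  suffices hst : s + t = 0 by
    have hs0 : s = 0 := by linarith
    have ht0 : t = 0 := by linarith
    subst hs0; subst ht0
    have : r ^ 2 = 0 := by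
      rw [← hN2, hN]; simp
    exact ⟨pow_eq_zero_iff two_ne_zero |>.1 this, rfl, rfl⟩
  have h2 : 0 ≤ (1 - κ) / 2 * (s - t) ^ 2 := mul_nonneg (by linarith) (sq_nonneg _)
  rcases le_or_gt 0 κ with hκ0 | hκ0
  · have hr3 : r ^ 2 ≤ (κ * (s + t)) ^ 2 :=
      pow_le_pow_left₀ hr hr2 2
    have key : (1 - κ) * (1 + 2 * κ) * (s + t) ^ 2 ≤ 0 := by nlinarith
    have hpos : 0 < (1 - κ) * (1 + 2 * κ) := mul_pos (by linarith) (by linarith)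
    have hsq : (s + t) ^ 2 ≤ 0 := by
      by_contra hlt
      have := mul_pos hpos (not_le.1 hlt)
      linarith
    exact pow_eq_zero_iff two_ne_zero |>.1 (le_antisymm hsq (sq_nonneg _))
  · have hr0 : r ≤ 0 := hr2.trans (mul_nonpos_of_nonpos_of_nonneg hκ0.le (by linarith))
    have hr00 : r = 0 := le_antisymm hr0 hr
    have hN0 : N = 0 := by rw [hN2, hr00]; ring
    have h1 : 0 ≤ (1 + κ) / 2 * (s + t) ^ 2 := mul_nonneg (by linarith) (sq_nonneg _)
    have : (1 + κ) / 2 * (s + t) ^ 2 = 0 := by linarith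
    rcases mul_eq_zero.1 this with h | h
    · exact absurd h (by linarith)
    · exact pow_eq_zero_iff two_ne_zero |>.1 h

/-- Two unit vectors with `⟪v, w⟫² < 1` (i.e. `w ≠ ±v`) are not collinear with the origin.
[folklore] -/
theorem not_collinear_of_sq_inner_lt_one {v w : F} (hv : ‖v‖ = 1) (hw : ‖w‖ = 1)
    (hvw : ⟪v, w⟫ ^ 2 < 1) : ¬ Collinear ℝ ({(0 : F), v, w} : Set F) := by
  intro hcol
  rw [collinear_iff_of_mem (Set.mem_insert _ _)] at hcol
  obtain ⟨u, hu⟩ := hcol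
  obtain ⟨r, hr⟩ := hu v (by simp)
  obtain ⟨r', hr'⟩ := hu w (by simp)
  rw [vadd_eq_add, add_zero] at hr hr'
  have hvv : ⟪v, v⟫ = 1 := by rw [real_inner_self_eq_norm_sq, hv]; norm_num
  have hww : ⟪w, w⟫ = 1 := by rw [real_inner_self_eq_norm_sq, hw]; norm_num
  have hvw' : ⟪v, w⟫ = r' * (r * ⟪u, u⟫) := by
    rw [hr, hr']; simp only [real_inner_smul_left, real_inner_smul_right]
  rw [hr] at hvv
  rw [hr'] at hww
  simp only [real_inner_smul_left, real_inner_smul_right] at hvv hww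
  have key : (r' * (r * ⟪u, u⟫)) ^ 2 = (r * (r * ⟪u, u⟫)) * (r' * (r' * ⟪u, u⟫)) := by ring
  rw [← hvw', hvv, hww] at key
  rw [key] at hvw
  norm_num at hvw

end UnitCone

/-! ### Part B. The contact graph of a spherical code at level `κ` and its fan -/

section ContactGraph

variable {F : Type*} [NormedAddCommGroup F] [InnerProductSpace ℝ F]

/-- **The contact graph of a spherical code at level `κ`.**  For `X ⊂ S^{n-1}` (unit vectors of a
real inner product space) and `κ ∈ ℝ`, two distinct points are adjacent iff `⟪x, y⟫ = κ`.  With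
`κ = cos ψ(X)` the largest inner product between distinct points of `X` (`ψ(X)` the minimal
angular distance), this is Musin–Tarasov's contact graph `CG(X)`: "the graph with vertices in `X`
and edges `(x, y)`, `x, y ∈ X` such that `dist(x, y) = ψ(X)`".
[cite: MusinTarasov2012, §2.1 (Contact graphs)] -/
def codeContactGraph (S : Set F) (κ : ℝ) : SimpleGraph S where
  Adj x y := x ≠ y ∧ ⟪(x : F), y⟫ = κ
  symm := ⟨fun _ _ h => ⟨h.1.symm, by rw [real_inner_comm]; exact h.2⟩⟩
  loopless := ⟨fun _ h => h.1 rfl⟩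

/-- Adjacency in the contact graph at level `κ`. [cite: MusinTarasov2012, §2.1] -/
@[simp] theorem codeContactGraph_adj {S : Set F} {κ : ℝ} {x y : S} :
    (codeContactGraph S κ).Adj x y ↔ x ≠ y ∧ ⟪(x : F), y⟫ = κ := Iff.rfl

/-- For unit vectors, `dist x y = m ↔ ⟪x, y⟫ = 1 − m²/2` (`m ≥ 0`). [folklore] -/
theorem dist_eq_iff_inner_eq_of_unit {x y : F} (hx : ‖x‖ = 1) (hy : ‖y‖ = 1) {m : ℝ} (hm : 0 ≤ m) :
    dist x y = m ↔ ⟪x, y⟫ = 1 - m ^ 2 / 2 := by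
  have h2 : dist x y ^ 2 = 2 - 2 * ⟪x, y⟫ := by
    rw [dist_eq_norm, norm_sub_sq_real, hx, hy]; ring
  constructor
  · intro h
    rw [h] at h2
    linarith
  · intro h
    have : dist x y ^ 2 = m ^ 2 := by rw [h2, h]; ring
    exact (pow_left_inj₀ dist_nonneg hm two_ne_zero).1 this

/-- For unit vectors, `m ≤ dist x y ↔ ⟪x, y⟫ ≤ 1 − m²/2` (`m ≥ 0`). [folklore] -/
theorem le_dist_iff_inner_le_of_unit {x y : F} (hx : ‖x‖ = 1) (hy : ‖y‖ = 1) {m : ℝ} (hm : 0 ≤ m) :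
    m ≤ dist x y ↔ ⟪x, y⟫ ≤ 1 - m ^ 2 / 2 := by
  have h2 : dist x y ^ 2 = 2 - 2 * ⟪x, y⟫ := by
    rw [dist_eq_norm, norm_sub_sq_real, hx, hy]; ring
  constructor
  · intro h
    have : m ^ 2 ≤ dist x y ^ 2 := pow_le_pow_left₀ hm h 2
    linarith
  · intro h
    have : m ^ 2 ≤ dist x y ^ 2 := by rw [h2]; linarith
    exact (pow_le_pow_iff_left₀ hm dist_nonneg two_ne_zero).1 this

/-- **In distance form**: with `κ = 1 − m²/2`, adjacency at level `κ` is `dist x y = m`, i.e. for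
`m = min_{x ≠ y} dist` the graph `codeContactGraph S (1 − m²/2)` is the contact graph `CG(S)` of
Musin–Tarasov (and for `m = 2 sin(π/6) = 1` on the unit sphere it is the kissing contact graph).
[cite: MusinTarasov2012, §2.1 (Contact graphs)] -/
theorem codeContactGraph_adj_iff_dist {S : Set F} (hn : ∀ x ∈ S, ‖x‖ = 1) {m : ℝ} (hm : 0 ≤ m)
    {x y : S} : (codeContactGraph S (1 - m ^ 2 / 2)).Adj x y ↔ x ≠ y ∧ dist (x : F) y = m := by
  rw [codeContactGraph_adj, dist_eq_iff_inner_eq_of_unit (hn x x.2) (hn y y.2) hm]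

/-- **Musin–Tarasov 2012, Proposition 3.1 — "Let `X` be a finite set in `S²`. Then `CG(X)` is a
planar graph" — in the form: the contact graph is a FAN (Hales).**  Let `S` be a finite nonempty
set of unit vectors of a real inner product space and `κ > −1` a level such that
`⟪x, y⟫ ≤ κ` for all distinct `x, y ∈ S` (i.e. `κ ≥ cos ψ(S)`; the graph is `CG(S)` when
`κ = cos ψ(S)` and has no edges when `κ > cos ψ(S)`).  Then `(S, codeContactGraph S κ)` is a fan:
`0 ∉ S`, no edge is collinear with `0`, and the cones over any two cells (edges or nodes) meet
exactly in the cone over their common part — in particular the geodesic arcs of two contact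
edges without a common endpoint do not intersect, and two contact edges at a common vertex
overlap only in that vertex, which is the planarity of the geodesic drawing of `CG(S)` used in
the printed proof ("the shortest arcs `ab` and `xy` don't intersect. Otherwise, the length of at
least one of the arcs `ax, ay, bx, by` has to be less than `ψ(X)`").  The printed statement is for
`S² ⊂ ℝ³`; the inner-product proof here works in any dimension (where "planar" is to be read as
"fan").  The kissing case `κ = 1/2` on `S²(2)` is `isFan_contactGraph` of `Fan.lean`.
[cite: MusinTarasov2012, Proposition 3.1] -/
theorem isFan_codeContactGraph {S : Set F} {κ : ℝ} (hfin : S.Finite) (hne : S.Nonempty)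
    (hn : ∀ x ∈ S, ‖x‖ = 1) (hκ : -1 < κ) (hS : ∀ x ∈ S, ∀ y ∈ S, x ≠ y → ⟪x, y⟫ ≤ κ) :
    IsFan S (codeContactGraph S κ) := by
  have hne' : ∀ {x y : S}, x ≠ y → (x : F) ≠ y := fun h e => h (Subtype.val_injective e)
  have hle : ∀ {x y : S}, x ≠ y → ⟪(x : F), y⟫ ≤ κ := fun {x y} h =>
    hS x x.2 y y.2 (hne' h)
  -- an edge forces `κ < 1`
  have hκ1 : ∀ {x y : S}, (codeContactGraph S κ).Adj x y → κ < 1 := fun {x y} h => by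
    rw [← h.2]; exact inner_lt_one_of_ne_unit (hn x x.2) (hn y y.2) (hne' h.1)
  refine isFan_of_cone_inter hfin hne (fun h => by simpa using hn 0 h) ?_ ?_ ?_ ?_ ?_
  · intro v w hvw
    refine not_collinear_of_sq_inner_lt_one (hn v v.2) (hn w w.2) ?_
    have h1 := hκ1 hvw
    rw [hvw.2]
    nlinarith
  · -- two node rays
    intro u v huv x ⟨hxu, hxv⟩
    obtain ⟨s, hs, rfl⟩ := mem_cone_singleton.1 hxu
    obtain ⟨r, hr, hx⟩ := mem_cone_singleton.1 hxv
    obtain ⟨rfl, -⟩ := eq_zero_of_ray_ray (by rw [hn u u.2, hn v v.2]) (by rw [hn u u.2]; norm_num)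
      (hne' huv) hs hr hx.symm
    simp
  · -- blade against node ray
    intro a b c hab hca hcb x ⟨hxab, hxc⟩
    obtain ⟨s, t, hs, ht, rfl⟩ := mem_cone_pair.1 hxab
    obtain ⟨r, hr, hx⟩ := mem_cone_singleton.1 hxc
    obtain ⟨-, rfl, rfl⟩ := unit_eq_zero_of_edge_pair_ray (hn a a.2) (hn b b.2) (hn c c.2) (hκ1 hab)
      hκ hab.2 (hle (Ne.symm hca)) (hle (Ne.symm hcb)) hs ht hr hx.symm
    simp
  · -- two blades with a common node
    intro a b c hab hac hbc x ⟨hxab, hxac⟩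
    obtain ⟨s, t, hs, ht, rfl⟩ := mem_cone_pair.1 hxab
    obtain ⟨s', t', hs', ht', hx⟩ := mem_cone_pair.1 hxac
    obtain ⟨rfl, -⟩ := unit_eq_zero_of_edge_pair_shared (hn b b.2) (hn c c.2) (hne' hbc)
      (hab.2.trans hac.2.symm) ht ht' hx.symm
    exact mem_cone_singleton.2 ⟨s, hs, by simp⟩
  · -- two disjoint blades
    intro a b c d hab hcd hac had hbc hbd x ⟨hxab, hxcd⟩
    obtain ⟨s, t, hs, ht, rfl⟩ := mem_cone_pair.1 hxab
    obtain ⟨s', t', hs', ht', hx⟩ := mem_cone_pair.1 hxcd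
    obtain ⟨rfl, rfl⟩ := unit_eq_zero_of_edge_pair_pair (hn a a.2) (hn b b.2) (hn c c.2) (hn d d.2)
      (hκ1 hab) hκ hab.2 hcd.2 (hle hac) (hle had) (hle hbc) (hle hbd) hs ht hs' ht' hx.symm
    simp

/-- **Distance form of Proposition 3.1.**  If `S` is a finite nonempty set of unit vectors with
pairwise distances `≥ m`, where `0 ≤ m < 2`, then the graph of pairs at distance exactly `m` is a
fan.  (For `m = ψ(S)` realised, this is `CG(S)`; `m < 2` excludes only the antipodal pair
`S = {v, −v}`, whose single "edge" is collinear with `0`.)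
[cite: MusinTarasov2012, Proposition 3.1] -/
theorem isFan_codeContactGraph_of_le_dist {S : Set F} (hfin : S.Finite) (hne : S.Nonempty)
    (hn : ∀ x ∈ S, ‖x‖ = 1) {m : ℝ} (hm0 : 0 ≤ m) (hm2 : m < 2)
    (hS : ∀ x ∈ S, ∀ y ∈ S, x ≠ y → m ≤ dist x y) :
    IsFan S (codeContactGraph S (1 - m ^ 2 / 2)) := by
  refine isFan_codeContactGraph hfin hne hn ?_ fun x hx y hy hxy =>
    (le_dist_iff_inner_le_of_unit (hn x hx) (hn y hy) hm0).1 (hS x hx y hy hxy)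
  nlinarith

/-- In particular (the printed planarity statement): the geodesic arcs of two contact edges
without a common endpoint do not meet — their cones intersect only at the origin.
[cite: MusinTarasov2012, Proposition 3.1] -/
theorem cone_pair_inter_cone_pair_of_codeContactGraph {S : Set F} {κ : ℝ} (hfin : S.Finite)
    (hn : ∀ x ∈ S, ‖x‖ = 1) (hκ : -1 < κ) (hS : ∀ x ∈ S, ∀ y ∈ S, x ≠ y → ⟪x, y⟫ ≤ κ) {a b c d : S}
    (hab : (codeContactGraph S κ).Adj a b) (hcd : (codeContactGraph S κ).Adj c d) (hac : a ≠ c)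
    (had : a ≠ d) (hbc : b ≠ c) (hbd : b ≠ d) :
    cone ({(a : F), (b : F)} : Set F) ∩ cone {(c : F), (d : F)} = {0} := by
  have hF := isFan_codeContactGraph hfin ⟨a, a.2⟩ hn hκ hS
  rw [hF.cone_inter_cone (pair_mem_fanCells hab) (pair_mem_fanCells hcd)]
  have ne' : ∀ {u v : S}, u ≠ v → (u : F) ≠ v := fun h e => h (Subtype.val_injective e)
  rw [pair_inter_pair_eq_empty (ne' hac) (ne' had) (ne' hbc) (ne' hbd), cone_empty]

end ContactGraph

/-! ### Part C. Angles at a vertex: the bound `α(ψ)` and at most five neighbours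
(Propositions 3.3, 3.6 (ii), 3.7) -/

section Tangent

variable {F : Type*} [NormedAddCommGroup F] [InnerProductSpace ℝ F]

/-- The component of `u` orthogonal to the unit vector `v` (the initial direction, scaled by
`sin`, of the geodesic from `v` to `u`). [folklore] -/
def tangentProj (v u : F) : F := u - ⟪v, u⟫ • v

/-- `⟪t_v u, t_v u'⟫ = ⟪u, u'⟫ − ⟪v, u⟫⟪v, u'⟫` for a unit vector `v`. [folklore] -/
theorem inner_tangentProj (v u u' : F) (hv : ‖v‖ = 1) :
    ⟪tangentProj v u, tangentProj v u'⟫ = ⟪u, u'⟫ - ⟪v, u⟫ * ⟪v, u'⟫ := by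
  have hvv : ⟪v, v⟫ = 1 := by rw [real_inner_self_eq_norm_sq, hv]; norm_num
  simp only [tangentProj, inner_sub_left, inner_sub_right, real_inner_smul_left,
    real_inner_smul_right, hvv]
  rw [real_inner_comm v u, real_inner_comm u' v]
  ring

/-- `‖t_v u‖² = 1 − ⟪v, u⟫²` for unit vectors `v, u`. [folklore] -/
theorem norm_sq_tangentProj {v u : F} (hv : ‖v‖ = 1) (hu : ‖u‖ = 1) :
    ‖tangentProj v u‖ ^ 2 = 1 - ⟪v, u⟫ ^ 2 := by
  rw [← real_inner_self_eq_norm_sq, inner_tangentProj v u u hv, real_inner_self_eq_norm_sq, hu]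
  ring

/-- **The angle bound `α(ψ)` (Musin–Tarasov, Proposition 3.6 (ii) with 3.7).**  Let `v, u, u'` be
unit vectors with `⟪v, u⟫ = ⟪v, u'⟫ = κ` (two contact neighbours of `v` at level `κ = cos ψ`) and
`⟪u, u'⟫ ≤ κ` (the neighbours are at angular distance `≥ ψ`).  Then the angle at `v` between the
arcs `vu` and `vu'` has cosine `≤ κ/(1 + κ) = cos ψ/(1 + cos ψ)`, i.e. it is at least
`α(ψ) = arccos (cos ψ/(1 + cos ψ))`, "the angle of a regular triangle in `S²` with sides of
length `ψ`" — with equality iff `⟪u, u'⟫ = κ` (Proposition 3.7: a triangular face is regular with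
all angles `α`).  In tangent components: `⟪t_v u, t_v u'⟫ = ⟪u, u'⟫ − κ² ≤ κ(1 − κ)` and
`‖t_v u‖² = ‖t_v u'‖² = 1 − κ² = (1 − κ)(1 + κ)`.
[cite: MusinTarasov2012, Proposition 3.6 (ii) and Proposition 3.7] -/
theorem inner_tangentProj_le {v u u' : F} (hv : ‖v‖ = 1) {κ : ℝ} (hu : ⟪v, u⟫ = κ)
    (hu' : ⟪v, u'⟫ = κ) (huu' : ⟪u, u'⟫ ≤ κ) :
    ⟪tangentProj v u, tangentProj v u'⟫ ≤ κ * (1 - κ) := by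
  rw [inner_tangentProj v u u' hv, hu, hu']
  nlinarith

/-- The same bound in the normalised form `cos ∠ ≤ κ/(1+κ)`:
`(1 + κ) ⟪t_v u, t_v u'⟫ ≤ κ ‖t_v u‖ ‖t_v u'‖` (both tangent components have norm `√(1 − κ²)`).
[cite: MusinTarasov2012, Proposition 3.6 (ii)] -/
theorem inner_tangentProj_le' {v u u' : F} (hv : ‖v‖ = 1) (hun : ‖u‖ = 1) (hun' : ‖u'‖ = 1)
    {κ : ℝ} (hu : ⟪v, u⟫ = κ) (hu' : ⟪v, u'⟫ = κ) (huu' : ⟪u, u'⟫ ≤ κ) :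
    (1 + κ) * ⟪tangentProj v u, tangentProj v u'⟫ ≤
      κ * (‖tangentProj v u‖ * ‖tangentProj v u'‖) := by
  have h1 : ‖tangentProj v u‖ ^ 2 = 1 - κ ^ 2 := by rw [norm_sq_tangentProj hv hun, hu]
  have h2 : ‖tangentProj v u'‖ ^ 2 = 1 - κ ^ 2 := by rw [norm_sq_tangentProj hv hun', hu']
  have heq : ‖tangentProj v u‖ = ‖tangentProj v u'‖ := by
    have := h1.trans h2.symm
    exact (pow_left_inj₀ (norm_nonneg _) (norm_nonneg _) two_ne_zero).1 this
  rw [← heq, ← sq, h1]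
  have hκ : -1 ≤ κ := by
    have habs := abs_real_inner_le_norm v u
    rw [hv, hun, hu, one_mul] at habs
    exact neg_le_of_abs_le habs
  have := inner_tangentProj_le hv hu hu' huu'
  nlinarith [mul_le_mul_of_nonneg_left this (by linarith : (0 : ℝ) ≤ 1 + κ)]

/-- **Equality case (Proposition 3.7, regular triangles).**  If moreover `⟪u, u'⟫ = κ` (the three
points are pairwise in contact) then `⟪t_v u, t_v u'⟫ = κ(1 − κ)`, i.e. the angle at `v` is exactly
`α(ψ) = arccos (κ/(1 + κ))`. [cite: MusinTarasov2012, Proposition 3.7] -/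
theorem inner_tangentProj_eq {v u u' : F} (hv : ‖v‖ = 1) {κ : ℝ} (hu : ⟪v, u⟫ = κ)
    (hu' : ⟪v, u'⟫ = κ) (huu' : ⟪u, u'⟫ = κ) :
    ⟪tangentProj v u, tangentProj v u'⟫ = κ * (1 - κ) := by
  rw [inner_tangentProj v u u' hv, hu, hu', huu']
  ring

end Tangent

section Degree

/-- `cos g < 1/2` with `g ≥ 0` forces `g > π/3`. [folklore] -/
theorem pi_div_three_lt_of_cos_lt_half {g : ℝ} (h0 : 0 ≤ g) (hc : cos g < 1 / 2) : π / 3 < g := by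
  by_contra hle
  push Not at hle
  have : cos (π / 3) ≤ cos g :=
    cos_le_cos_of_nonneg_of_le_pi h0 (by linarith [pi_pos]) hle
  rw [cos_pi_div_three] at this
  linarith

/-- **No six gaps.** Six nonnegative angles summing to `2π` cannot all have cosine `< 1/2`
(each would exceed `π/3`). [folklore] -/
theorem six_gaps_false (g : Fin 6 → ℝ) (h0 : ∀ k, 0 ≤ g k)
    (hsum : g 0 + g 1 + g 2 + g 3 + g 4 + g 5 = 2 * π) (hc : ∀ k, cos (g k) < 1 / 2) : False := by
  have h := fun k => pi_div_three_lt_of_cos_lt_half (h0 k) (hc k)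
  have e0 := h 0; have e1 := h 1; have e2 := h 2; have e3 := h 3; have e4 := h 4; have e5 := h 5
  linarith

/-- **No six sorted directions.** Six angles `−π < t₀ < t₁ < ⋯ < t₅ ≤ π` such that every
difference `tᵢ − tⱼ` (`i ≠ j`) has cosine `< 1/2` do not exist (apply `six_gaps_false` to the five
consecutive gaps and the wrap-around gap `2π − (t₅ − t₀)`). [folklore] -/
theorem six_sorted_angles_false (t : Fin 6 → ℝ) (hmono : StrictMono t) (hlo : -π < t 0)
    (hhi : t 5 ≤ π) (hC : ∀ i j, i ≠ j → cos (t i - t j) < 1 / 2) : False := by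
  have h01 : t 0 < t 1 := hmono (by decide)
  have h12 : t 1 < t 2 := hmono (by decide)
  have h23 : t 2 < t 3 := hmono (by decide)
  have h34 : t 3 < t 4 := hmono (by decide)
  have h45 : t 4 < t 5 := hmono (by decide)
  have hw : cos (2 * π - (t 5 - t 0)) = cos (t 5 - t 0) := cos_two_pi_sub _
  refine six_gaps_false
    ![t 1 - t 0, t 2 - t 1, t 3 - t 2, t 4 - t 3, t 5 - t 4, 2 * π - (t 5 - t 0)] ?_ ?_ ?_
  · intro k
    fin_cases k <;> simp <;> linarith
  · simp only [Matrix.cons_val_zero, Matrix.cons_val_one, Matrix.cons_val]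
    ring
  · intro k
    fin_cases k
    · simpa using hC 1 0 (by decide)
    · simpa using hC 2 1 (by decide)
    · simpa using hC 3 2 (by decide)
    · simpa using hC 4 3 (by decide)
    · simpa using hC 5 4 (by decide)
    · simpa [hw] using hC 5 0 (by decide)

/-- An orthonormal basis of `ℝ³` whose third vector is the unit vector `v`. [folklore] -/
theorem exists_orthonormalBasis_third_eq_unit {v : EuclideanSpace ℝ (Fin 3)} (hv : ‖v‖ = 1) :
    ∃ b : OrthonormalBasis (Fin 3) ℝ (EuclideanSpace ℝ (Fin 3)), b 2 = v := by
  have hcard : Module.finrank ℝ (EuclideanSpace ℝ (Fin 3)) = Fintype.card (Fin 3) := by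
    rw [finrank_euclideanSpace_fin, Fintype.card_fin]
  haveI : Subsingleton (↥({2} : Set (Fin 3))) :=
    (Set.subsingleton_coe _).2 Set.subsingleton_singleton
  have hon : Orthonormal ℝ (({2} : Set (Fin 3)).restrict fun _ : Fin 3 => v) := by
    rw [orthonormal_subsingleton_iff]
    intro i
    simpa using hv
  obtain ⟨b, hb⟩ := Orthonormal.exists_orthonormalBasis_extension_of_card_eq hcard hon
  exact ⟨b, hb 2 rfl⟩

/-- **Polar form.** If `X² + Y² = R ≥ 0` and `θ = arg (X + iY)` then `X = √R cos θ`,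
`Y = √R sin θ`. [folklore] -/
theorem eq_sqrt_mul_cos_sin_arg {X Y R : ℝ} (h : X ^ 2 + Y ^ 2 = R) :
    X = √R * cos (Complex.arg ⟨X, Y⟩) ∧ Y = √R * sin (Complex.arg ⟨X, Y⟩) := by
  have hn : ‖(⟨X, Y⟩ : ℂ)‖ = √R := by
    rw [Complex.norm_def, Complex.normSq_mk, ← h]
    congr 1
    ring
  refine ⟨?_, ?_⟩
  · have := Complex.norm_mul_cos_arg ⟨X, Y⟩
    rw [hn] at this
    exact this.symm
  · have := Complex.norm_mul_sin_arg ⟨X, Y⟩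
    rw [hn] at this
    exact this.symm

/-- Hence `X X' + Y Y' = R cos (θ − θ')` for two plane vectors of squared length `R ≥ 0`.
[folklore] -/
theorem mul_add_mul_eq_mul_cos {X Y X' Y' R : ℝ} (hR : 0 ≤ R) (h : X ^ 2 + Y ^ 2 = R)
    (h' : X' ^ 2 + Y' ^ 2 = R) :
    X * X' + Y * Y' = R * cos (Complex.arg ⟨X, Y⟩ - Complex.arg ⟨X', Y'⟩) := by
  set θ := Complex.arg ⟨X, Y⟩ with hθ
  set θ' := Complex.arg ⟨X', Y'⟩ with hθ'
  obtain ⟨hX, hY⟩ := eq_sqrt_mul_cos_sin_arg h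
  obtain ⟨hX', hY'⟩ := eq_sqrt_mul_cos_sin_arg h'
  rw [← hθ] at hX hY
  rw [← hθ'] at hX' hY'
  have hRR : √R * √R = R := Real.mul_self_sqrt hR
  rw [cos_sub]
  linear_combination X' * hX + √R * cos θ * hX' + cos θ * cos θ' * hRR + Y' * hY +
    √R * sin θ * hY' + sin θ * sin θ' * hRR

/-- **No point of `S²` has six contact neighbours (Musin–Tarasov, Proposition 3.3, upper bound:
"degrees of its vertices can take only the values `0`, `3`, `4`, or `5`" — the part that needs no
irreducibility).**  Let `v ∈ S²` be a unit vector, `κ ∈ (-1, 1)`, and `u₀, …, u₅` six distinct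
unit vectors with `⟪v, uₖ⟫ = κ` (at angular distance `ψ = arccos κ` from `v`) and
`⟪uᵢ, uⱼ⟫ ≤ κ` (pairwise at distance `≥ ψ`).  Contradiction: in an orthonormal frame with third
vector `v` each `uₖ` is `(Xₖ, Yₖ, κ)` with `Xₖ² + Yₖ² = 1 − κ²`; with `θₖ = arg (Xₖ + iYₖ)`,
`⟪uᵢ, uⱼ⟫ = (1 − κ²) cos (θᵢ − θⱼ) + κ² ≤ κ` gives `cos (θᵢ − θⱼ) ≤ κ/(1+κ) < 1/2`, and six sorted
directions with pairwise angular gaps `> π/3` do not fit around a circle.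
[cite: MusinTarasov2012, Proposition 3.3] -/
theorem no_six_neighbours {v : EuclideanSpace ℝ (Fin 3)} (hv : ‖v‖ = 1) {κ : ℝ} (hκ₁ : κ < 1)
    (hκ₂ : -1 < κ) (u : Fin 6 → EuclideanSpace ℝ (Fin 3)) (hinj : Function.Injective u)
    (hn : ∀ k, ‖u k‖ = 1)
    (hc : ∀ k, ⟪v, u k⟫ = κ) (hsep : ∀ i j, i ≠ j → ⟪u i, u j⟫ ≤ κ) : False := by
  obtain ⟨b, hb⟩ := exists_orthonormalBasis_third_eq_unit hv
  -- tangent coordinates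
  set X : Fin 6 → ℝ := fun k => ⟪b 0, u k⟫ with hXdef
  set Y : Fin 6 → ℝ := fun k => ⟪b 1, u k⟫ with hYdef
  have hZ : ∀ k, ⟪b 2, u k⟫ = κ := fun k => by rw [hb, hc k]
  set R : ℝ := 1 - κ ^ 2 with hRdef
  have hR0 : 0 ≤ R := by rw [hRdef]; nlinarith
  have hXY : ∀ k, X k ^ 2 + Y k ^ 2 = R := by
    intro k
    have h1 : ⟪u k, u k⟫ = 1 := by
      rw [real_inner_self_eq_norm_sq, hn k]; norm_num
    rw [inner_eq_sum_three b, hZ k] at h1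
    simp only [hXdef, hYdef, hRdef]
    nlinarith [h1]
  set θ : Fin 6 → ℝ := fun k => Complex.arg ⟨X k, Y k⟩ with hθdef
  have hinner : ∀ i j, ⟪u i, u j⟫ = R * cos (θ i - θ j) + κ ^ 2 := by
    intro i j
    have hcs := mul_add_mul_eq_mul_cos hR0 (hXY i) (hXY j)
    rw [inner_eq_sum_three b, hZ i, hZ j]
    simp only [hθdef]
    linarith [hcs]
  have hθinj : Function.Injective θ := by
    intro i j hij
    apply hinj
    obtain ⟨hXi, hYi⟩ := eq_sqrt_mul_cos_sin_arg (hXY i)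
    obtain ⟨hXj, hYj⟩ := eq_sqrt_mul_cos_sin_arg (hXY j)
    have hij' : Complex.arg ⟨X i, Y i⟩ = Complex.arg ⟨X j, Y j⟩ := hij
    refine eq_of_inner_basis_eq b fun m => ?_
    fin_cases m
    · show X i = X j
      rw [hXi, hXj, hij']
    · show Y i = Y j
      rw [hYi, hYj, hij']
    · simp only [Fin.reduceFinMk, hZ]
  -- the pairwise constraints: `cos (θ i - θ j) < 1/2`
  have hC : ∀ i j, i ≠ j → cos (θ i - θ j) < 1 / 2 := by
    intro i j hij
    have h1 := hsep i j hij
    rw [hinner i j] at h1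
    -- `(1 - κ²) c + κ² ≤ κ`, i.e. `(1 - κ)((1 + κ) c - κ) ≤ 0`, so `(1 + κ) c ≤ κ < (1 + κ)/2`
    have h2 : (1 - κ) * ((1 + κ) * cos (θ i - θ j) - κ) ≤ 0 := by
      rw [hRdef] at h1; nlinarith [h1]
    have h3 : (1 + κ) * cos (θ i - θ j) - κ ≤ 0 := by
      by_contra hlt
      have := mul_pos (show (0 : ℝ) < 1 - κ by linarith) (not_le.1 hlt)
      linarith
    by_contra hge
    push Not at hge
    have : (1 + κ) * (1 / 2) ≤ (1 + κ) * cos (θ i - θ j) :=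
      mul_le_mul_of_nonneg_left hge (by linarith)
    linarith
  -- sort the six angles
  have hAcard : (Finset.univ.image θ).card = 6 := by
    rw [Finset.card_image_of_injective _ hθinj, Finset.card_univ, Fintype.card_fin]
  let e := (Finset.univ.image θ).orderEmbOfFin hAcard
  have hmem : ∀ k, ∃ i, θ i = e k := by
    intro k
    have := (Finset.univ.image θ).orderEmbOfFin_mem hAcard k
    rw [Finset.mem_image] at this
    obtain ⟨i, -, hi⟩ := this
    exact ⟨i, hi⟩
  choose π' hπ' using hmem
  refine six_sorted_angles_false (fun k => e k) e.strictMono ?_ ?_ ?_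
  · show -π < e 0
    rw [← hπ' 0]
    exact Complex.neg_pi_lt_arg _
  · show e 5 ≤ π
    rw [← hπ' 5]
    exact Complex.arg_le_pi _
  · intro i j hij
    have hne : π' i ≠ π' j := by
      intro h
      apply hij
      apply e.injective
      rw [← hπ' i, ← hπ' j, h]
    rw [← hπ' i, ← hπ' j]
    exact hC _ _ hne

/-- **At most five neighbours (finite-set form).**  If every point of the finite set `N` of unit
vectors of `ℝ³` has inner product `κ ∈ (-1, 1)` with the unit vector `v`, and any two distinct
points of `N` have inner product `≤ κ`, then `|N| ≤ 5`. [cite: MusinTarasov2012, Proposition 3.3] -/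
theorem card_le_five_of_neighbours {v : EuclideanSpace ℝ (Fin 3)} (hv : ‖v‖ = 1) {κ : ℝ}
    (hκ₁ : κ < 1) (hκ₂ : -1 < κ) {N : Finset (EuclideanSpace ℝ (Fin 3))} (hn : ∀ u ∈ N, ‖u‖ = 1)
    (hc : ∀ u ∈ N, ⟪v, u⟫ = κ)
    (hsep : ∀ u ∈ N, ∀ w ∈ N, u ≠ w → ⟪u, w⟫ ≤ κ) : N.card ≤ 5 := by
  by_contra h
  obtain ⟨N', hN', hcard⟩ := Finset.exists_subset_card_eq (show 6 ≤ N.card by omega)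
  set e := (Finset.equivFinOfCardEq hcard).symm with he
  refine no_six_neighbours hv hκ₁ hκ₂ (fun k => ((e k : N') : EuclideanSpace ℝ (Fin 3)))
    (Subtype.val_injective.comp e.injective) (fun k => hn _ (hN' (e k).2))
    (fun k => hc _ (hN' (e k).2)) fun i j hij => hsep _ (hN' (e i).2) _ (hN' (e j).2) ?_
  exact fun h => hij (e.injective (Subtype.val_injective h))

/-- **At most five neighbours (set form)**: under the same hypotheses an arbitrary set `T` is
finite with `T.ncard ≤ 5`. [cite: MusinTarasov2012, Proposition 3.3] -/
theorem finite_and_ncard_le_five_of_neighbours {v : EuclideanSpace ℝ (Fin 3)} (hv : ‖v‖ = 1)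
    {κ : ℝ} (hκ₁ : κ < 1) (hκ₂ : -1 < κ) {T : Set (EuclideanSpace ℝ (Fin 3))}
    (hn : ∀ u ∈ T, ‖u‖ = 1) (hc : ∀ u ∈ T, ⟪v, u⟫ = κ)
    (hsep : ∀ u ∈ T, ∀ w ∈ T, u ≠ w → ⟪u, w⟫ ≤ κ) : T.Finite ∧ T.ncard ≤ 5 := by
  have key : ∀ N : Finset (EuclideanSpace ℝ (Fin 3)), (↑N : Set (EuclideanSpace ℝ (Fin 3))) ⊆ T →
      N.card ≤ 5 := fun N hN =>
    card_le_five_of_neighbours hv hκ₁ hκ₂ (fun u hu => hn u (hN hu)) (fun u hu => hc u (hN hu))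
      fun u hu w hw => hsep u (hN hu) w (hN hw)
  have hfin : T.Finite := by
    by_contra hinf
    obtain ⟨t, ht, htfin, htcard⟩ := Set.Infinite.exists_subset_ncard_eq hinf 6
    have h5 := key htfin.toFinset (by simpa using ht)
    rw [Set.ncard_eq_toFinset_card t htfin] at htcard
    omega
  refine ⟨hfin, ?_⟩
  rw [Set.ncard_eq_toFinset_card T hfin]
  exact key _ (by simp)

/-- **Musin–Tarasov 2012, Proposition 3.3 (degree `≤ 5`), graph form.**  In the contact graph at
level `κ > −1` of a set `S ⊂ S²` of unit vectors with pairwise inner products `≤ κ` (i.e.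
`κ = cos ψ(S)`, or any larger level), every vertex has at most five neighbours.  (The printed
proposition says more for IRREDUCIBLE contact graphs — degrees `1` and `2` are then excluded as
well; that part rests on Danzer's shifts and is not formalised here.)
[cite: MusinTarasov2012, Proposition 3.3] -/
theorem ncard_neighborSet_codeContactGraph_le_five {S : Set (EuclideanSpace ℝ (Fin 3))} {κ : ℝ}
    (hn : ∀ x ∈ S, ‖x‖ = 1) (hκ : -1 < κ) (hS : ∀ x ∈ S, ∀ y ∈ S, x ≠ y → ⟪x, y⟫ ≤ κ) (v : S) :
    ((codeContactGraph S κ).neighborSet v).ncard ≤ 5 := by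
  by_cases hκ₁ : κ < 1
  · have h := (finite_and_ncard_le_five_of_neighbours (v := (v : EuclideanSpace ℝ (Fin 3)))
      (T := Subtype.val '' (codeContactGraph S κ).neighborSet v) (hn v v.2) hκ₁ hκ ?_ ?_ ?_).2
    · rwa [Set.ncard_image_of_injective _ Subtype.val_injective] at h
    · rintro _ ⟨u, -, rfl⟩
      exact hn u u.2
    · rintro _ ⟨u, hu, rfl⟩
      rw [SimpleGraph.mem_neighborSet, codeContactGraph_adj] at hu
      exact hu.2
    · rintro _ ⟨u, -, rfl⟩ _ ⟨w, -, rfl⟩ hne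
      exact hS u u.2 w w.2 hne
  · -- no edges at a level `κ ≥ 1`
    have hempty : (codeContactGraph S κ).neighborSet v = ∅ := by
      ext u
      simp only [SimpleGraph.mem_neighborSet, codeContactGraph_adj, Set.mem_empty_iff_false,
        iff_false, not_and]
      intro hvu h
      have := inner_lt_one_of_ne_unit (hn v v.2) (hn u u.2)
        (fun e => hvu (Subtype.val_injective e))
      linarith
    rw [hempty, Set.ncard_empty]
    norm_num

/-- Degree form. [cite: MusinTarasov2012, Proposition 3.3] -/
theorem degree_codeContactGraph_le_five {S : Set (EuclideanSpace ℝ (Fin 3))} {κ : ℝ}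
    (hn : ∀ x ∈ S, ‖x‖ = 1) (hκ : -1 < κ) (hS : ∀ x ∈ S, ∀ y ∈ S, x ≠ y → ⟪x, y⟫ ≤ κ) (v : S)
    [Fintype ((codeContactGraph S κ).neighborSet v)] : (codeContactGraph S κ).degree v ≤ 5 := by
  rw [← SimpleGraph.card_neighborSet_eq_degree, ← Nat.card_eq_fintype_card, Nat.card_coe_set_eq]
  exact ncard_neighborSet_codeContactGraph_le_five hn hκ hS v

/-- Hence the maximum degree of a contact graph on `S²` is `≤ 5`, and by the handshake lemma a
contact graph on `N` points of `S²` has at most `5N/2` edges (for `N = 13`: at most `32`).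
[cite: MusinTarasov2012, Proposition 3.3] -/
theorem card_edgeFinset_codeContactGraph_le {S : Set (EuclideanSpace ℝ (Fin 3))} {κ : ℝ}
    (hn : ∀ x ∈ S, ‖x‖ = 1) (hκ : -1 < κ) (hS : ∀ x ∈ S, ∀ y ∈ S, x ≠ y → ⟪x, y⟫ ≤ κ) [Fintype S]
    [DecidableRel (codeContactGraph S κ).Adj] :
    2 * (codeContactGraph S κ).edgeFinset.card ≤ 5 * Fintype.card S := by
  have h1 := (codeContactGraph S κ).sum_degrees_eq_twice_card_edges
  have h2 : ∑ v, (codeContactGraph S κ).degree v ≤ ∑ _v : S, 5 :=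
    Finset.sum_le_sum fun v _ => degree_codeContactGraph_le_five hn hκ hS v
  simp only [Finset.sum_const, Finset.card_univ, smul_eq_mul] at h2
  omega

end Degree

end Literature.Geometry.DiscreteGeometry

end
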